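import Summits.Ventures.YMGap.FlowData.RectTubeMassGapPrime
import Summits.Ventures.YMGap.FlowData.RectTubeTransferPositivity
import Literature.Analysis.OperatorTheory.CompactPositiveTopLevel
import HarnessLib

/-!
# Venture YMGap, track Y3 FLOW-DATA — the EXCITED TRIVIAL-FLUX TOP `λ̂* = ‖T ∘ (P_0 − P_Ω)‖` of `m′` IS AN ATTAINED
# EIGENVALUE of the rectangular tube transfer operator, carried by a trivial-flux state ORTHOGONAL TO THE VACUUM, and the
# largest one there (theorems only)

HONEST FRAMING: venture file of the cell `pub-ymgap` (QuantumFields programme), track Y3; the DICTIONARY theorem for the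
typed `e = 0` gap of `RectTubeVacuumProjection.lean` / `RectTubeMassGapPrime.lean`.  FLOW-PLAN O5 defines
`m′ := ln(λ̂₀/λ̂*)`, `λ̂* = second-largest eigenvalue of T̂ on the whole e = 0 space`; the tree types `m′` through the OPERATOR
NORM `rectTubeExcitedNorm = ‖T ∘ (P_0 − P_Ω)‖`.  This file proves the two readings coincide.  First an ABSTRACT lemma (real
Hilbert space): for a compact self-adjoint positive `T` and a self-adjoint idempotent `Q` commuting with `T`, if `T ∘ Q ≠ 0`
there is a unit `φ` with `Q φ = φ` and `T φ = ‖T ∘ Q‖ φ`, and every eigenvalue of `T` carried by the range of `Q` lies in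
`[0, ‖T ∘ Q‖]` (Hilbert–Schmidt theorem for the compact positive operator `T ∘ Q`, tree
`CompactPositiveTopLevel.exists_eigenvector_norm_of_re_inner_nonneg`).  Then `Q := P_0 − P_Ω` on the rectangular tube
(continuous unitary `ρ`, central involution `z`, `J ≥ 0`): by the vacuum package of `RectTubeMassGapPrime`
(`P_Ω = ⟪φ₀, ·⟫ φ₀`, `P_0 φ₀ = φ₀`, `T φ₀ = ‖T‖ φ₀`) it is a self-adjoint idempotent commuting with `T`, whence:

* `exists_eigenvector_norm_comp_of_idempotent`, `eigenvalue_mem_Icc_of_idempotent` — the abstract lemma;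
* `rectExcitedProjection_*` — `Q = P_0 − P_Ω` is self-adjoint, idempotent, commutes with `T`, kills `φ₀`, and `Q φ = φ`
  iff (`P_0 φ = φ` and `⟪φ₀, φ⟫ = 0`);
* ★ `exists_eigenvector_rectTubeExcitedNorm` — `0 < ‖T ∘ (P_0 − P_Ω)‖ →` there is a unit `φ` with `P_0 φ = φ`,
  `⟪φ₀, φ⟫ = 0` and `T φ = ‖T ∘ (P_0 − P_Ω)‖ · φ` (`φ₀` the vacuum): `λ̂*` is an attained eigenvalue on a trivial-flux state
  orthogonal to the vacuum;
* `rect_excited_eigenvalue_mem_Icc` — every eigenvalue of `T` on a trivial-flux state orthogonal to the vacuum lies in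
  `[0, λ̂*]`: `λ̂*` is the largest of them, i.e. the second-largest eigenvalue of `T̂` on the `e = 0` space;
* `su2_exists_eigenvector_rectExcitedNorm` — the cell's case (`SU(2)`, `J = β/2`, `β > 0`) GIVEN `0 < su2RectExcitedNorm β Ls`
  (a tree theorem of `RectTubeMassGapPrimePos`, `su2_rectExcitedNorm_pos`; taken as a hypothesis here only to keep this
  file's imports built), with `su2RectMassGapPrime β Ls = log λ̂₀ − log λ̂*`.

Finite rectangular torus, one transfer step; nothing about `L → ∞`, the continuum or a mass gap in the thermodynamic
sense; no number, no row.

References: M. Reed, B. Simon I (1980) Thm VI.16 [cite: ReedSimonI1980, Thm. VI.16]; IV (1978) XIII.12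
[cite: ReedSimonIV1978, Thm XIII.44]; M. Lüscher, Commun. Math. Phys. 54 (1977) 283 [cite: Luscher1977].
-/

noncomputable section

open scoped InnerProductSpace
open MeasureTheory
open Literature.MathematicalPhysics.QuantumFieldTheory Literature.Analysis.OperatorTheory
open Literature.MathematicalPhysics.QuantumLattice (fundamentalRep continuous_fundamentalRep fundamentalRep_mem_unitaryGroup)

namespace Summit.Ventures.YMGap.FlowData

/-! ### Abstract: top of a reducing subspace of a compact positive operator -/

section Abstract

variable {H : Type*} [NormedAddCommGroup H] [InnerProductSpace ℝ H] [CompleteSpace H]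

/-- **Top of a reducing subspace is an attained eigenvalue.**  `T` compact, self-adjoint, `⟪x, Tx⟫ ≥ 0`; `Q` a self-adjoint
idempotent commuting with `T`; `T ∘ Q ≠ 0`.  Then there is a unit `φ` with `Q φ = φ` and `T φ = ‖T ∘ Q‖ • φ`.
[cite: ReedSimonI1980, Thm. VI.16] -/
theorem exists_eigenvector_norm_comp_of_idempotent {T Q : H →L[ℝ] H} (hT : IsSelfAdjoint T) (hTc : IsCompactOperator T)
    (hpos : ∀ x : H, 0 ≤ ⟪x, T x⟫_ℝ) (hQ : IsSelfAdjoint Q) (hQQ : Q.comp Q = Q) (hcomm : Q.comp T = T.comp Q)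
    (hne : T.comp Q ≠ 0) :
    ∃ φ : H, ‖φ‖ = 1 ∧ Q φ = φ ∧ T φ = ‖T.comp Q‖ • φ := by
  obtain ⟨x, hx⟩ := DFunLike.ne_iff.1 hne
  haveI : Nontrivial H := nontrivial_of_ne _ _ hx
  -- `T ∘ Q` is compact, self-adjoint and positive
  have hSc : IsCompactOperator (T.comp Q) := hTc.comp_clm Q
  have hSsa : IsSelfAdjoint (T.comp Q) := by
    have hc : Commute T Q := by
      change T * Q = Q * T
      rw [ContinuousLinearMap.mul_def, ContinuousLinearMap.mul_def]; exact hcomm.symm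
    exact (IsSelfAdjoint.commute_iff hT hQ).1 hc
  have happly : ∀ y : H, (T.comp Q) y = Q (T (Q y)) := fun y => by
    have := congrArg (fun S : H →L[ℝ] H => S y)
      (show T.comp Q = (Q.comp T).comp Q by rw [hcomm, ContinuousLinearMap.comp_assoc, hQQ])
    simpa using this
  have hSpos : ∀ y : H, 0 ≤ RCLike.re ⟪y, (T.comp Q) y⟫_ℝ := fun y => by
    have h : ⟪y, (T.comp Q) y⟫_ℝ = ⟪Q y, T (Q y)⟫_ℝ := by
      rw [happly, ← ContinuousLinearMap.adjoint_inner_left, hQ.adjoint_eq]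
    rw [RCLike.re_to_real, h]
    exact hpos (Q y)
  obtain ⟨φ, hφ1, hφ⟩ := exists_eigenvector_norm_of_re_inner_nonneg (𝕜 := ℝ) hSsa hSc hSpos
  have hφ' : T (Q φ) = ‖T.comp Q‖ • φ := by simpa using hφ
  have hnorm : ‖T.comp Q‖ ≠ 0 := norm_ne_zero_iff.2 hne
  have hQφ : Q φ = φ := by
    have h1 : Q (T (Q φ)) = T (Q φ) := by rw [← happly]; rfl
    rw [hφ', map_smul] at h1
    have h2 := congrArg (fun v => ‖T.comp Q‖⁻¹ • v) h1
    simp only [smul_smul, inv_mul_cancel₀ hnorm, one_smul] at h2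
    exact h2
  exact ⟨φ, hφ1, hQφ, by rw [← hφ', hQφ]⟩

omit [CompleteSpace H] in
/-- **Maximality**: with `T` positive, every eigenvalue carried by the range of `Q` lies in `[0, ‖T ∘ Q‖]`.
[cite: ReedSimonIV1978, Thm XIII.44] -/
theorem eigenvalue_mem_Icc_of_idempotent {T Q : H →L[ℝ] H} (hpos : ∀ x : H, 0 ≤ ⟪x, T x⟫_ℝ) {ψ : H} {μ : ℝ}
    (hψQ : Q ψ = ψ) (hψ : ψ ≠ 0) (heig : T ψ = μ • ψ) : μ ∈ Set.Icc 0 ‖T.comp Q‖ := by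
  have hψn : 0 < ‖ψ‖ := norm_pos_iff.2 hψ
  constructor
  · have h := hpos ψ
    rw [heig, inner_smul_right, real_inner_self_eq_norm_sq] at h
    nlinarith [h, pow_pos hψn 2]
  · have h1 : (T.comp Q) ψ = μ • ψ := by simp [hψQ, heig]
    have h2 : ‖(T.comp Q) ψ‖ ≤ ‖T.comp Q‖ * ‖ψ‖ := (T.comp Q).le_opNorm ψ
    rw [h1, norm_smul, Real.norm_eq_abs] at h2
    exact (le_abs_self μ).trans (le_of_mul_le_mul_right h2 hψn)

end Abstract

/-! ### The excited trivial-flux projection `Q = P_0 − P_Ω` of the rectangular tube -/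

section Excited

variable {G : Type*} [Group G] [TopologicalSpace G] [IsTopologicalGroup G] [CompactSpace G]
  [MeasurableSpace G] [BorelSpace G] [SecondCountableTopology G] {n : ℕ} (ρ : G →* Matrix (Fin n) (Fin n) ℂ)
  (J : ℝ) {k : ℕ} {Ls : Fin k → ℕ} [∀ i, NeZero (Ls i)]

/-- ★ **The excited trivial-flux top is an attained eigenvalue.**  For continuous unitary `ρ`, a central involution `z`,
`J ≥ 0` and `‖T ∘ (P_0 − P_Ω)‖ > 0`: with `φ₀` the vacuum (`T φ₀ = ‖T‖ φ₀`, the unit a.e.-positive top eigenvector) there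
is a unit `φ` with `P_0 φ = φ`, `⟪φ₀, φ⟫ = 0` and `T φ = ‖T ∘ (P_0 − P_Ω)‖ · φ`. [cite: ReedSimonI1980, Thm. VI.16] -/
theorem exists_eigenvector_rectTubeExcitedNorm (hρ : Continuous ρ) (hρu : ∀ g, ρ g ∈ Matrix.unitaryGroup (Fin n) ℂ)
    {z : G} (hz : z ∈ Subgroup.center G) (hz2 : z * z = 1) (hJ : 0 ≤ J)
    (hpos : 0 < rectTubeExcitedNorm ρ z J Ls) :
    ∃ φ₀ φ : Lp ℝ 2 (rectSliceMeasure G Ls), ‖φ₀‖ = 1 ∧ ‖φ‖ = 1 ∧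
      rectTubeTransferOperator ρ J Ls φ₀ = ‖rectTubeTransferOperator ρ J Ls‖ • φ₀ ∧
      rectTubeFluxProjection z Ls 0 φ = φ ∧ @inner ℝ _ _ φ₀ φ = 0 ∧
      rectTubeTransferOperator ρ J Ls φ = rectTubeExcitedNorm ρ z J Ls • φ := by
  set T := rectTubeTransferOperator ρ J Ls
  set P := rectTubeFluxProjection z Ls (0 : Fin k → ZMod 2)
  obtain ⟨φ₀, h01, -, h0eig, -, hP0, hvac, -⟩ := exists_rectVacuum_gap ρ J hρ hρu hz (Ls := Ls)
  set PΩ := rectTubeVacuumProjection ρ J Ls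
  have hS : rectTubeExcitedNorm ρ z J Ls = ‖T.comp (P - PΩ)‖ := rfl
  -- structure of `Q = P − PΩ`
  have hTsa := isSelfAdjoint_rectTubeTransferOperator J Ls hρ hρu
  have hPsa : IsSelfAdjoint P := isSelfAdjoint_rectTubeFluxProjection z hz2 (Ls := Ls) 0
  have hPP : P.comp P = P := rectTubeFluxProjection_comp_self z hz2 0
  have hPT : P.comp T = T.comp P := rectTubeFluxProjection_comp_rectTubeTransferOperator ρ J hρ hz 0
  have hΩ_apply : ∀ ψ, PΩ ψ = (@inner ℝ _ _ φ₀ ψ) • φ₀ := hvac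
  have hΩsa : IsSelfAdjoint PΩ := by
    rw [ContinuousLinearMap.isSelfAdjoint_iff_isSymmetric]
    intro x y
    simp only [ContinuousLinearMap.coe_coe, hΩ_apply, real_inner_smul_left, real_inner_smul_right]
    rw [real_inner_comm φ₀ x]; ring
  have hΩΩ : PΩ.comp PΩ = PΩ := by
    refine ContinuousLinearMap.ext fun ψ => ?_
    rw [ContinuousLinearMap.comp_apply, hΩ_apply (PΩ ψ), hΩ_apply ψ, inner_smul_right, real_inner_self_eq_norm_sq,
      h01, one_pow, mul_one]
  have hPΩ : P.comp PΩ = PΩ := by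
    refine ContinuousLinearMap.ext fun ψ => ?_
    rw [ContinuousLinearMap.comp_apply, hΩ_apply, map_smul, hP0]
  have hΩP : PΩ.comp P = PΩ := by
    refine ContinuousLinearMap.ext fun ψ => ?_
    rw [ContinuousLinearMap.comp_apply, hΩ_apply (P ψ), hΩ_apply ψ, ← ContinuousLinearMap.adjoint_inner_left P,
      hPsa.adjoint_eq, hP0]
  have hΩT : PΩ.comp T = T.comp PΩ := by
    refine ContinuousLinearMap.ext fun ψ => ?_
    rw [ContinuousLinearMap.comp_apply, ContinuousLinearMap.comp_apply, hΩ_apply (T ψ), hΩ_apply ψ, map_smul, h0eig,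
      smul_smul, ← ContinuousLinearMap.adjoint_inner_left T, hTsa.adjoint_eq, h0eig, real_inner_smul_left, mul_comm]
  have hQsa : IsSelfAdjoint (P - PΩ) := hPsa.sub hΩsa
  have hQQ : (P - PΩ).comp (P - PΩ) = P - PΩ := by
    rw [ContinuousLinearMap.comp_sub, ContinuousLinearMap.sub_comp, ContinuousLinearMap.sub_comp, hPP, hΩP, hPΩ, hΩΩ]
    abel
  have hQT : (P - PΩ).comp T = T.comp (P - PΩ) := by
    rw [ContinuousLinearMap.sub_comp, ContinuousLinearMap.comp_sub, hPT, hΩT]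
  have hne : T.comp (P - PΩ) ≠ 0 := by
    intro h; rw [hS, h, norm_zero] at hpos; exact lt_irrefl _ hpos
  obtain ⟨φ, hφ1, hQφ, hTφ⟩ := exists_eigenvector_norm_comp_of_idempotent hTsa
    (isCompactOperator_rectTubeTransferOperator J Ls hρ) (fun x => inner_rectTubeTransferOperator_self_nonneg ρ hρ hρu hJ x)
    hQsa hQQ hQT hne
  -- unpack `Q φ = φ`: `PΩ φ = PΩ Q φ = 0`, hence `⟪φ₀, φ⟫ = 0` and `P φ = φ`
  have hΩQ : PΩ.comp (P - PΩ) = 0 := by rw [ContinuousLinearMap.comp_sub, hΩP, hΩΩ, sub_self]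
  have hΩφ : PΩ φ = 0 := by
    have h : PΩ ((P - PΩ) φ) = 0 := by
      rw [← ContinuousLinearMap.comp_apply, hΩQ]; rfl
    rwa [hQφ] at h
  have hinner : @inner ℝ _ _ φ₀ φ = 0 := by
    have h := hΩφ
    rw [hΩ_apply] at h
    rcases smul_eq_zero.1 h with h | h
    · exact h
    · exfalso; rw [h, norm_zero] at h01; exact zero_ne_one h01
  have hPφ : P φ = φ := by
    have h : P φ - PΩ φ = φ := hQφ
    rw [hΩφ, sub_zero] at h
    exact h
  exact ⟨φ₀, φ, h01, hφ1, h0eig, hPφ, hinner, by rw [hS]; exact hTφ⟩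

/-- **`λ̂*` is the largest eigenvalue of `T` on trivial-flux states orthogonal to the vacuum** (`J ≥ 0`): if `P_0 ψ = ψ`,
`⟪φ₀, ψ⟫ = 0` for the vacuum `φ₀` of `exists_rectVacuum_gap`, `ψ ≠ 0` and `T ψ = μ ψ`, then `μ ∈ [0, ‖T ∘ (P_0 − P_Ω)‖]`.
[cite: ReedSimonIV1978, Thm XIII.44] -/
theorem rect_excited_eigenvalue_mem_Icc (hρ : Continuous ρ) (hρu : ∀ g, ρ g ∈ Matrix.unitaryGroup (Fin n) ℂ)
    (z : G) (hJ : 0 ≤ J) {ψ : Lp ℝ 2 (rectSliceMeasure G Ls)} {μ : ℝ}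
    (hψP : rectTubeFluxProjection z Ls 0 ψ = ψ) (hψΩ : rectTubeVacuumProjection ρ J Ls ψ = 0) (hψ : ψ ≠ 0)
    (heig : rectTubeTransferOperator ρ J Ls ψ = μ • ψ) :
    μ ∈ Set.Icc 0 (rectTubeExcitedNorm ρ z J Ls) := by
  have hQψ : (rectTubeFluxProjection z Ls 0 - rectTubeVacuumProjection ρ J Ls) ψ = ψ := by
    show rectTubeFluxProjection z Ls 0 ψ - rectTubeVacuumProjection ρ J Ls ψ = ψ
    rw [hψP, hψΩ, sub_zero]
  exact eigenvalue_mem_Icc_of_idempotent (fun x => inner_rectTubeTransferOperator_self_nonneg ρ hρ hρu hJ x) hQψ hψ heig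

/-- The vacuum projection kills exactly the vectors orthogonal to the vacuum: `P_Ω ψ = 0 ↔ ⟪φ₀, ψ⟫ = 0` for any unit top
eigenvector `φ₀` spanning the (simple) top eigenspace. [cite: ReedSimonIV1978, §XIII.12] -/
theorem rectTubeVacuumProjection_eq_zero_iff (hρ : Continuous ρ) (hρu : ∀ g, ρ g ∈ Matrix.unitaryGroup (Fin n) ℂ)
    {z : G} (hz : z ∈ Subgroup.center G) (ψ : Lp ℝ 2 (rectSliceMeasure G Ls)) :
    rectTubeVacuumProjection ρ J Ls ψ = 0 ↔
      ∀ φ₀ : Lp ℝ 2 (rectSliceMeasure G Ls), ‖φ₀‖ = 1 →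
        rectTubeTransferOperator ρ J Ls φ₀ = ‖rectTubeTransferOperator ρ J Ls‖ • φ₀ → @inner ℝ _ _ φ₀ ψ = 0 := by
  obtain ⟨φ₀, h01, -, h0eig, -, -, hvac, -⟩ := exists_rectVacuum_gap ρ J hρ hρu hz (Ls := Ls)
  obtain ⟨φ₁, h11, -, h1eig, hsimple, -⟩ := exists_rectVacuum ρ J hρ hρu hz (Ls := Ls)
  constructor
  · intro h η hη1 hηeig
    -- `η` and `φ₀` are both multiples of `φ₁`
    have hη : η = (@inner ℝ _ _ φ₁ η) • φ₁ := hsimple η hηeig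
    have hφ : φ₀ = (@inner ℝ _ _ φ₁ φ₀) • φ₁ := hsimple φ₀ h0eig
    have h0 : (@inner ℝ _ _ φ₀ ψ) • φ₀ = 0 := by rw [← hvac]; exact h
    rcases smul_eq_zero.1 h0 with h0 | h0
    · rw [hφ, real_inner_smul_left] at h0
      rcases mul_eq_zero.1 h0 with hc | hc
      · exfalso
        have : ‖φ₀‖ = 0 := by rw [hφ, norm_smul, hc, norm_zero, zero_mul]
        rw [h01] at this; exact one_ne_zero this
      · rw [hη, real_inner_smul_left, hc, mul_zero]
    · exfalso; rw [h0, norm_zero] at h01; exact zero_ne_one h01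
  · intro h
    rw [hvac, h φ₀ h01 h0eig, zero_smul]

end Excited

/-! ### The cell's case: `SU(2)`, fundamental representation, `z = −1`, `J = β/2` -/

section SU2

variable {k : ℕ}

/-- **The cell's `λ̂*` is an attained eigenvalue** (`SU(2)`, `J = β/2`, `β > 0`), GIVEN `0 < su2RectExcitedNorm β Ls`
(= the tree's `RectTubeMassGapPrimePos.su2_rectExcitedNorm_pos`, hypothesis-free there): a unit vacuum `φ₀` and a unit
trivial-flux `φ ⊥ φ₀` with `T̂ φ₀ = λ̂₀ φ₀`, `T̂ φ = λ̂* φ`, and `su2RectMassGapPrime β Ls = log λ̂₀ − log λ̂*`.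
[cite: ReedSimonI1980, Thm. VI.16] -/
theorem su2_exists_eigenvector_rectExcitedNorm {β : ℝ} (hβ : 0 < β) (Ls : Fin k → ℕ) [∀ i, NeZero (Ls i)]
    (hpos : 0 < su2RectExcitedNorm β Ls) :
    ∃ φ₀ φ : Lp ℝ 2 (rectSliceMeasure (Matrix.specialUnitaryGroup (Fin 2) ℂ) Ls), ‖φ₀‖ = 1 ∧ ‖φ‖ = 1 ∧
      rectTubeTransferOperator (fundamentalRep (Fin 2)) (β / 2) Ls φ₀ =
        ‖rectTubeTransferOperator (fundamentalRep (Fin 2)) (β / 2) Ls‖ • φ₀ ∧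
      rectTubeFluxProjection su2MinusOne Ls 0 φ = φ ∧ @inner ℝ _ _ φ₀ φ = 0 ∧
      rectTubeTransferOperator (fundamentalRep (Fin 2)) (β / 2) Ls φ = su2RectExcitedNorm β Ls • φ ∧
      su2RectMassGapPrime β Ls =
        Real.log ‖rectTubeTransferOperator (fundamentalRep (Fin 2)) (β / 2) Ls‖ - Real.log (su2RectExcitedNorm β Ls) := by
  haveI : SecondCountableTopology (Matrix.specialUnitaryGroup (Fin 2) ℂ) :=
    Literature.MathematicalPhysics.QuantumLattice.secondCountableTopology_su2
  obtain ⟨φ₀, φ, h01, hφ1, h0eig, hPφ, hinner, hTφ⟩ := exists_eigenvector_rectTubeExcitedNorm (fundamentalRep (Fin 2))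
    (β / 2) (continuous_fundamentalRep (Fin 2)) fundamentalRep_mem_unitaryGroup su2MinusOne_mem_center su2MinusOne_mul_self
    (by linarith) hpos
  exact ⟨φ₀, φ, h01, hφ1, h0eig, hPφ, hinner, hTφ, rfl⟩

end SU2

end Summit.Ventures.YMGap.FlowData
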